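import Summits.BirchSwinnertonDyer.BirchSwinnertonDyer.Theorems.ManinLocalTwoThreeCuspValuesOfTranslates
import HarnessLib

/-!
# Cusp values along translates, II: the translated presentation near `i∞` and the pole case
(route `ManinLocalTwoThree`, crux C2 `ManinOddAtFour` stmt-BirchSwinnertonDyer-22967; cell bsd-f2-manin, prover seat p2 gen 23;
`--supports stmt-BirchSwinnertonDyer-22967`; sequel of `…CuspValuesOfTranslates` (p766229), step (2) of the LEAD's road to T-es-75)

For `f ∈ S₂(Γ₀(N))` nonzero, `g ∈ SL₂(ℤ)` with `g∞ ≠ ∞`, `c ≠ 0` and a lattice `Λ = Λ(L)`: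
* §1 `tendsto_smul_eichlerIntegral_nhdsNE` — `c·ℰ_f(gτ) → z₀ := c·{∞,g∞}_f` WITHIN `≠ z₀` (`ℰ_f(gτ) = {∞,g∞} + V_{f∣g}(τ)` with
  `V_{f∣g} ≠ 0` high in the cusp, `verticalIntegral_slash_ne_zero` / `IsCuspFunction.exists_forall_ne_zero`);
  `eventually_smul_eichlerIntegral_notMem` — `c·ℰ_f(gτ) ∉ Λ` eventually at `i∞` (whether or not `z₀ ∈ Λ`; no poles near the cusp);
* §2 `eventually_slash_presentation` — a presentation `G·w(c·ℰ_f) = F` off the poles on `ℍ` becomes, after translating by `g`,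
  `(G ∣[k] g)(τ)·w(c·ℰ_f(gτ)) = (F ∣[k] g)(τ)` eventually at `i∞` (slash bookkeeping `(F ∣[k] g)(τ) = F(gτ)·j(g,τ)^{-k}`);
* §3 THE POLE CASE: if `z₀ ∈ Λ` then `‖℘_Λ(c·ℰ_f(gτ))‖ → ∞` (`PeriodPair.order_weierstrassP`: double pole,
  `tendsto_cobounded_of_meromorphicOrderAt_neg`), hence for a translated `℘`-presentation `Ψ·℘_Λ(c·ℰ_f(g·)) = Φ` some `q_h`-coefficient of
  `Φ` below the first non-vanishing coefficient of `Ψ` is nonzero (`exists_coeff_ne_zero_of_mem_lattice`); with `…CuspValuesOfTranslates`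
  §4 this decides `π(c·{∞,g∞}_f) = O` versus `≠ O` and, off `O`, reads both coordinates off `q_h`-coefficients — the data a Galois action on
  coefficients of translates transports.

Fact-free; nothing about T-es-75, C2, Manin's conjecture or BSD is proved here.  No definitions, no sorry.
[cite: Manin1972, Prop. 1.4 and §1.5] [cite: ShimuraIATAF1971, §6.1–6.2]
-/

set_option autoImplicit false
-- lint-debt: the directory name repeats the summit name (sibling precedent `ManinLocalTwoThreeCuspValuesOfTranslates.lean`)
set_option linter.dupNamespace false

noncomputable section

open scoped MatrixGroups ModularForm Topology PeriodPair
open Complex Filter Function CongruenceSubgroup Bornology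
open UpperHalfPlane hiding I
open Literature.NumberTheory.EllipticCurves Literature.NumberTheory.EllipticCurves.ModularForms

namespace Summit.BirchSwinnertonDyer.BirchSwinnertonDyer.Theorems.ManinLocalTwoThree.CuspValues

variable {N : ℕ} [NeZero N]

/-! ## §1 `c·ℰ_f(gτ)` near `i∞`: tends to `z₀` within `≠ z₀`, misses the lattice -/

/-- `V_{f∣g}(τ) ≠ 0` eventually at `i∞` for `f ≠ 0`. [folklore] -/
theorem eventually_verticalIntegral_slash_ne_zero (f : CuspForm (Gamma0 N) 2) (hf : f ≠ 0) (g : SL(2, ℤ)) :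
    ∀ᶠ τ : ℍ in atImInfty, verticalIntegral (⇑f ∣[(2 : ℤ)] g) τ ≠ 0 := by
  obtain ⟨M, hM⟩ := (isCuspFunction_verticalIntegral_slash f g).exists_forall_ne_zero (verticalIntegral_slash_ne_zero f hf g)
  rw [Filter.Eventually, UpperHalfPlane.atImInfty_mem]
  exact ⟨M, fun τ hτ ↦ hM τ hτ⟩

/-- **`c·ℰ_f(gτ) → z₀ = c·{∞,g∞}_f` within `≠ z₀`** (`c ≠ 0`, `f ≠ 0`). [cite: Manin1972, Prop. 1.4 and §1.5] -/
theorem tendsto_smul_eichlerIntegral_nhdsNE (f : CuspForm (Gamma0 N) 2) (hf : f ≠ 0) (g : SL(2, ℤ))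
    (hg : (g 1 0 : ℤ) ≠ 0) {c : ℂ} (hc : c ≠ 0) :
    Tendsto (fun τ : ℍ ↦ c * eichlerIntegral f (g • τ)) atImInfty
      (𝓝[≠] (c * modularSymbol f (((g 0 0 : ℤ) : ℚ) / ((g 1 0 : ℤ) : ℚ)))) := by
  refine tendsto_nhdsWithin_iff.mpr ⟨(tendsto_eichlerIntegral_smul_atImInfty f g hg).const_mul c, ?_⟩
  filter_upwards [eventually_verticalIntegral_slash_ne_zero f hf g] with τ hτ
  rw [Set.mem_compl_iff, Set.mem_singleton_iff, modularSymbol_smul_infty f g hg τ]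
  intro h
  apply hτ
  have : c * verticalIntegral (⇑f ∣[(2 : ℤ)] g) τ = 0 := by linear_combination h
  exact (mul_eq_zero.mp this).resolve_left hc

/-- **No poles near the cusp `g∞`**: `c·ℰ_f(gτ) ∉ Λ` eventually at `i∞` (`Λ ∖ {z₀}` is closed and misses `z₀`, and `c·ℰ_f(gτ) ≠ z₀`
eventually). [cite: Manin1972, Prop. 1.4] -/
theorem eventually_smul_eichlerIntegral_notMem (f : CuspForm (Gamma0 N) 2) (hf : f ≠ 0) (L : PeriodPair) (g : SL(2, ℤ))
    (hg : (g 1 0 : ℤ) ≠ 0) {c : ℂ} (hc : c ≠ 0) :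
    ∀ᶠ τ : ℍ in atImInfty, c * eichlerIntegral f (g • τ) ∉ L.lattice := by
  set z₀ := c * modularSymbol f (((g 0 0 : ℤ) : ℚ) / ((g 1 0 : ℤ) : ℚ)) with hz₀
  have h := tendsto_smul_eichlerIntegral_nhdsNE f hf g hg hc
  have hmem : ∀ᶠ τ : ℍ in atImInfty, c * eichlerIntegral f (g • τ) ∈ (L.lattice \ {z₀} : Set ℂ)ᶜ ∩ {z₀}ᶜ :=
    h (inter_mem (mem_nhdsWithin_of_mem_nhds (L.compl_lattice_sdiff_singleton_mem_nhds z₀)) self_mem_nhdsWithin)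
  filter_upwards [hmem] with τ hτ hΛ
  exact hτ.1 ⟨hΛ, hτ.2⟩

/-! ## §2 The translated presentation -/

/-- **Translating a presentation.**  If `G(τ)·w(c·ℰ_f(τ)) = F(τ)` whenever `c·ℰ_f(τ) ∉ Λ` (on all of `ℍ`), then for every `g ∈ SL₂(ℤ)`
with `g∞ ≠ ∞`: `(G ∣[k] g)(τ)·w(c·ℰ_f(gτ)) = (F ∣[k] g)(τ)` eventually at `i∞`. [cite: ShimuraIATAF1971, §6.1–6.2] -/
theorem eventually_slash_presentation (f : CuspForm (Gamma0 N) 2) (hf : f ≠ 0) (L : PeriodPair) (g : SL(2, ℤ))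
    (hg : (g 1 0 : ℤ) ≠ 0) {c : ℂ} (hc : c ≠ 0) (k : ℤ) {F G : ℍ → ℂ} {w : ℂ → ℂ}
    (hpres : ∀ τ : ℍ, c * eichlerIntegral f τ ∉ L.lattice → G τ * w (c * eichlerIntegral f τ) = F τ) :
    ∀ᶠ τ : ℍ in atImInfty, (G ∣[k] g) τ * w (c * eichlerIntegral f (g • τ)) = (F ∣[k] g) τ := by
  filter_upwards [eventually_smul_eichlerIntegral_notMem f hf L g hg hc] with τ hτ
  rw [ModularForm.SL_slash_apply, ModularForm.SL_slash_apply, ← hpres (g • τ) hτ]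
  ring

/-! ## §3 The pole case -/

/-- **`‖℘_Λ(c·ℰ_f(gτ))‖ → ∞` when the cusp value is `O`**, i.e. when `z₀ = c·{∞,g∞}_f ∈ Λ` (double pole of `℘_Λ` at lattice points).
[cite: Manin1972, §1.5] -/
theorem tendsto_norm_weierstrassP_smul_eichlerIntegral_atTop (f : CuspForm (Gamma0 N) 2) (hf : f ≠ 0) (L : PeriodPair)
    (g : SL(2, ℤ)) (hg : (g 1 0 : ℤ) ≠ 0) {c : ℂ} (hc : c ≠ 0)
    (hz₀ : c * modularSymbol f (((g 0 0 : ℤ) : ℚ) / ((g 1 0 : ℤ) : ℚ)) ∈ L.lattice) :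
    Tendsto (fun τ : ℍ ↦ ‖℘[L] (c * eichlerIntegral f (g • τ))‖) atImInfty atTop := by
  have hord : meromorphicOrderAt ℘[L] (c * modularSymbol f (((g 0 0 : ℤ) : ℚ) / ((g 1 0 : ℤ) : ℚ))) < 0 := by
    rw [L.order_weierstrassP _ hz₀]; decide
  have h℘ := tendsto_cobounded_of_meromorphicOrderAt_neg hord
  rw [← tendsto_norm_atTop_iff_cobounded] at h℘
  exact h℘.comp (tendsto_smul_eichlerIntegral_nhdsNE f hf g hg hc)

/-- **The pole case in coefficients.**  For `h`-periodic `Φ, Ψ : ℍ → ℂ` with analytic cusp functions and a translated `℘`-presentation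
`Ψ(τ)·℘_Λ(c·ℰ_f(gτ)) = Φ(τ)` eventually at `i∞`: if the cusp value is `O` (`c·{∞,g∞}_f ∈ Λ`), then `Φ` has a nonzero
`q_h`-coefficient below the first non-vanishing coefficient `m` of `Ψ`.  (Contrapositive use: if `coeff_n Φ = 0` for all `n < m` — a
condition a Galois action on coefficients preserves — the cusp value is not `O`.)  Fact-free. [cite: Manin1972, §1.5] -/
theorem exists_coeff_ne_zero_of_mem_lattice {h : ℝ} (hh : 0 < h) (f : CuspForm (Gamma0 N) 2) (hf : f ≠ 0) (L : PeriodPair)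
    (g : SL(2, ℤ)) (hg : (g 1 0 : ℤ) ≠ 0) {c : ℂ} (hc : c ≠ 0)
    (hz₀ : c * modularSymbol f (((g 0 0 : ℤ) : ℚ) / ((g 1 0 : ℤ) : ℚ)) ∈ L.lattice)
    {Φ Ψ : ℍ → ℂ} (hΦp : Periodic (Φ ∘ ofComplex) h) (hΦa : AnalyticAt ℂ (cuspFunction h Φ) 0)
    (hΨp : Periodic (Ψ ∘ ofComplex) h) (hΨa : AnalyticAt ℂ (cuspFunction h Ψ) 0)
    (hpres : ∀ᶠ τ : ℍ in atImInfty, Ψ τ * ℘[L] (c * eichlerIntegral f (g • τ)) = Φ τ)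
    {m : ℕ} (hΨm : (qExpansion h Ψ).coeff m ≠ 0) (hΨlt : ∀ n < m, (qExpansion h Ψ).coeff n = 0) :
    ∃ n < m, (qExpansion h Φ).coeff n ≠ 0 :=
  qExpansion_exists_coeff_ne_zero_of_tendsto_norm_atTop hh hΦp hΦa hΨp hΨa hΨm hΨlt
    (tendsto_norm_weierstrassP_smul_eichlerIntegral_atTop f hf L g hg hc hz₀)
    (hpres.mono fun τ hτ ↦ by rw [← hτ, mul_comm])

/-- **Conversely (the regular case, restated): if `coeff_n Φ = 0` for all `n < m` then the cusp value is not `O`.** [cite: Manin1972, §1.5] -/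
theorem notMem_lattice_of_forall_coeff_eq_zero {h : ℝ} (hh : 0 < h) (f : CuspForm (Gamma0 N) 2) (hf : f ≠ 0) (L : PeriodPair)
    (g : SL(2, ℤ)) (hg : (g 1 0 : ℤ) ≠ 0) {c : ℂ} (hc : c ≠ 0)
    {Φ Ψ : ℍ → ℂ} (hΦp : Periodic (Φ ∘ ofComplex) h) (hΦa : AnalyticAt ℂ (cuspFunction h Φ) 0)
    (hΨp : Periodic (Ψ ∘ ofComplex) h) (hΨa : AnalyticAt ℂ (cuspFunction h Ψ) 0)
    (hpres : ∀ᶠ τ : ℍ in atImInfty, Ψ τ * ℘[L] (c * eichlerIntegral f (g • τ)) = Φ τ)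
    {m : ℕ} (hΨm : (qExpansion h Ψ).coeff m ≠ 0) (hΨlt : ∀ n < m, (qExpansion h Ψ).coeff n = 0)
    (hΦlt : ∀ n < m, (qExpansion h Φ).coeff n = 0) :
    c * modularSymbol f (((g 0 0 : ℤ) : ℚ) / ((g 1 0 : ℤ) : ℚ)) ∉ L.lattice := fun hz₀ ↦ by
  obtain ⟨n, hn, hne⟩ := exists_coeff_ne_zero_of_mem_lattice hh f hf L g hg hc hz₀ hΦp hΦa hΨp hΨa hpres hΨm hΨlt
  exact hne (hΦlt n hn)

end Summit.BirchSwinnertonDyer.BirchSwinnertonDyer.Theorems.ManinLocalTwoThree.CuspValues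

end
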